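import Mathlib
import Literature.NumberTheory.Congruences.ZolotarevLemma
import Literature.NumberTheory.Congruences.ZolotarevLemmaJacobi
import Literature.NumberTheory.Congruences.ZolotarevReciprocity
import HarnessLib

/-!
# The signature of a linear automorphism of a finite vector space over an odd finite field is the quadratic character of
# its determinant: `ϵ(m) = (det m / 𝔽_q)` (Frobenius; Brunyate–Clark, *Extending the Zolotarev–Frobenius approach to
# quadratic reciprocity*, §4.1 Theorem 4.1)

Layer `Literature/LinearAlgebra`, namespace `Literature.LinearAlgebra`; lane `lit-hodgefound` (Track 2 foundations library),
prover seat `lit-hodgefound-p06`, generation 49, self-proposed row g49-#7. Theorems only, all **proved**: no definition, no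
instance, no notation, no named fact. Uses the tree's Zolotarev lemma `NumberTheory/Congruences/ZolotarevLemma.lean`
(`sign_toPerm_eq_quadraticChar`: the sign of `x ↦ a x` on `𝔽_q` is `(a/𝔽_q)`), the product lemma
`ZolotarevLemmaJacobi.sign_prodCongr` ([BrunyateClark2014] Lemma 1.3 for two factors) and
`ZolotarevReciprocity.sign_eq_one_of_pow_odd_eq_one` (a permutation of odd order is even).

## Source, verbatim ([BrunyateClark2014] §4.1, held `paper:doi-10-1007-s11139-014-9635-y` p. 15)

"**Theorem 4.1.** Let `q` be an odd prime power, let `V` be a finite-dimensional `𝔽_q`-vector space, and let `GL(V)` denote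
the group of all `𝔽_q`-linear automorphisms of `V`. a) Every `m ∈ GL(V)` permutes the finite set `V` and thus has a signature
`ϵ(m)`. b) For all `m ∈ GL(V)`, we have `ϵ(m) = det(m) (mod 𝔽_q^{×2})`.
Proof. a) is immediate. As for b), the idea is to show on the one hand that there is exactly one nontrivial homomorphism
`GL(V) → {±1}` and then to exhibit some element `D ∈ GL(V)` with `ϵ(D) = −1`. Indeed: For any finite-dimensional vector space
over a field `F` of cardinality greater than `2`, the commutator subgroup of `GL(V)` is the special linear group `SL(V)`
[A, Thm. 4.7]. Thus every homomorphism from `GL(V)` to the commutative group `{±1}` factors through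
`GL(V)/SL(V) ≅ 𝔽_q^×`. Since `𝔽_q^×` is even order cyclic, there is a unique nontrivial homomorphism `GL(V) → {±1}`. Let
`u ∈ 𝔽_q^× ∖ 𝔽_q^{×2}`, and let `D` be the diagonal matrix with entries `u, 1, …, 1`. By Lemma 1.3, `ϵ(D) = −1`. So the
signature homomorphism `GL(V) → {±1}` is nontrivial and coincides with `m ↦ det(m) (mod 𝔽_q^{×2})`."

## What is typed, and the one deviation from the printed proof

`(det m / 𝔽_q)` is Mathlib's `quadraticChar F (det m)` (`= 1` on nonzero squares, `= −1` on non-squares), for any finite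
field `F` of odd characteristic (`ringChar F ≠ 2`, i.e. `q` odd).
* **`sign_toEquiv_eq_quadraticChar_det`** — Theorem 4.1 (b) for an `F`-linear automorphism `f : V ≃ₗ[F] V` of a finite
  `F`-module `V`: `sign f = quadraticChar F (det f)` (read in `ℤ`);
* `sign_eq_quadraticChar_det` — the same in coordinates: for an invertible matrix `A` over `F` and the permutation
  `σ : v ↦ A v` of `ι → F`, `sign σ = quadraticChar F (det A)`.
The printed proof kills `SL(V)` through "`GL(V)' = SL(V)`" [A = Artin, *Geometric Algebra*, Thm. 4.7]; Mathlib does not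
carry that statement but carries its generator form — every invertible matrix is a product of transvections and an
invertible diagonal matrix (`Matrix.diagonal_transvection_induction_of_det_ne_zero`).  So `SL` is killed generator by
generator: a transvection `T_{ij}(c)` induces a permutation of order dividing the odd prime `p = char F`
(`T_{ij}(c)^p = T_{ij}(p c) = 1`), hence an even one (`sign_eq_one_of_transvection`); and the printed diagonal step
(Lemma 1.3: `ϵ(diag(u, 1, …, 1)) = ϵ(m_u)^{q^{n−1}} = (u/𝔽_q)`, `sign_eq_quadraticChar_det_diagonal_update`) is iterated over
the diagonal entries (`sign_eq_quadraticChar_det_diagonal`); signatures and `quadraticChar F ∘ det` are both multiplicative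
(`sign_eq_quadraticChar_det_mul`); `T_{ij}(c)^m = T_{ij}(m c)` and `(v ↦ A v)^m = (v ↦ A^m v)` are private plumbing.

## References

* [BrunyateClark2014] A. Brunyate, P. L. Clark, *Extending the Zolotarev–Frobenius approach to quadratic reciprocity*,
  Ramanujan J. 37 (2015) 25–50, §4.1 Theorem 4.1 (and Lemma 1.3).
* G. Frobenius, *Über das quadratische Reziprozitätsgesetz I*, Sitzungsber. Preuss. Akad. Wiss. (1914) 335–349 (the
  origin of the `GL`-signature computation, as credited in [BrunyateClark2014] §1).
-/

open Equiv Equiv.Perm Matrix Literature.NumberTheory.Congruences.Zolotarev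

namespace Literature.LinearAlgebra

variable {F : Type*} [Field F] [Fintype F] [DecidableEq F]
variable {ι : Type*} [Fintype ι] [DecidableEq ι]

/-! ### Transvections induce even permutations -/

/-- `T_{ij}(c)^m = T_{ij}(m c)` for `i ≠ j`. [folklore] -/
private theorem transvection_pow {R : Type*} [CommRing R] {i j : ι} (h : i ≠ j) (c : R) (m : ℕ) :
    transvection i j c ^ m = transvection i j (m • c) := by
  induction m with
  | zero => rw [pow_zero, zero_smul, transvection_zero]
  | succ m ih => rw [pow_succ, ih, transvection_mul_transvection_same _ _ h, succ_nsmul]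

/-- The permutation `v ↦ A v` attached to a matrix: its powers are `v ↦ A^m v`. [folklore] -/
private theorem perm_pow_apply_of_coe_eq_mulVec {R : Type*} [CommRing R] {A : Matrix ι ι R} (σ : Perm (ι → R))
    (hσ : ∀ v, σ v = A *ᵥ v) (m : ℕ) (v : ι → R) : (σ ^ m) v = (A ^ m) *ᵥ v := by
  induction m generalizing v with
  | zero => rw [pow_zero, pow_zero, Perm.coe_one, id, one_mulVec]
  | succ m ih => rw [pow_succ', Perm.coe_mul, Function.comp_apply, ih, hσ, mulVec_mulVec, ← pow_succ']

/-- Over a finite field of ODD characteristic `p`, a transvection `T_{ij}(c)` permutes `ι → F` EVENLY: the permutation has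
order dividing `p` (`T_{ij}(c)^p = T_{ij}(p c) = 1`), and a permutation of odd order is even.
[cite: BrunyateClark2014, §4.1 Thm. 4.1 (proof: "`SL(V)` lies in the kernel")] -/
theorem sign_eq_one_of_transvection (hF : ringChar F ≠ 2) {i j : ι} (hij : i ≠ j) (c : F) (σ : Perm (ι → F))
    (hσ : ∀ v, σ v = transvection i j c *ᵥ v) : Perm.sign σ = 1 := by
  have hp : (ringChar F).Prime := CharP.char_is_prime F (ringChar F)
  refine sign_eq_one_of_pow_odd_eq_one (hp.odd_of_ne_two hF) (Equiv.ext fun v => ?_)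
  rw [perm_pow_apply_of_coe_eq_mulVec σ hσ, transvection_pow hij, nsmul_eq_mul, ringChar.Nat.cast_ringChar, zero_mul,
    transvection_zero, one_mulVec, Perm.coe_one, id]

/-! ### Multiplicativity, and the diagonal matrices (Lemma 1.3) -/

/-- Both sides of Theorem 4.1 (b) are multiplicative: if `sign(v ↦ A v) = (det A / F)` and `sign(v ↦ B v) = (det B / F)`
for invertible `A`, `B`, then `sign(v ↦ A B v) = (det (A B) / F)`. [cite: BrunyateClark2014, §4.1 Thm. 4.1 (proof)] -/
theorem sign_eq_quadraticChar_det_mul {A B : Matrix ι ι F} (hA : A.det ≠ 0) (hB : B.det ≠ 0)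
    (PA : ∀ τ : Perm (ι → F), (∀ v, τ v = A *ᵥ v) → ((Perm.sign τ : ℤˣ) : ℤ) = quadraticChar F A.det)
    (PB : ∀ τ : Perm (ι → F), (∀ v, τ v = B *ᵥ v) → ((Perm.sign τ : ℤˣ) : ℤ) = quadraticChar F B.det)
    (σ : Perm (ι → F)) (hσ : ∀ v, σ v = (A * B) *ᵥ v) :
    ((Perm.sign σ : ℤˣ) : ℤ) = quadraticChar F (A * B).det := by
  have hbij : ∀ M : Matrix ι ι F, M.det ≠ 0 → Function.Bijective fun v : ι → F => M *ᵥ v := fun M hM =>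
    have hu : IsUnit M := (Matrix.isUnit_iff_isUnit_det M).mpr (isUnit_iff_ne_zero.mpr hM)
    ⟨Matrix.mulVec_injective_iff_isUnit.mpr hu, Matrix.mulVec_surjective_iff_isUnit.mpr hu⟩
  obtain ⟨τA, hτA⟩ : ∃ τ : Perm (ι → F), ∀ v, τ v = A *ᵥ v := ⟨Equiv.ofBijective _ (hbij A hA), fun _ => rfl⟩
  obtain ⟨τB, hτB⟩ : ∃ τ : Perm (ι → F), ∀ v, τ v = B *ᵥ v := ⟨Equiv.ofBijective _ (hbij B hB), fun _ => rfl⟩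
  have hστ : σ = τA * τB := Equiv.ext fun v => by
    rw [hσ, Perm.coe_mul, Function.comp_apply, hτB, hτA, mulVec_mulVec]
  rw [hστ, Perm.sign_mul, Units.val_mul, PA τA hτA, PB τB hτB, det_mul, map_mul]

/-- **Lemma 1.3 (Product Lemma), the case used in Theorem 4.1**: the diagonal matrix `diag(1, …, u, …, 1)` (`u ≠ 0` in
place `i`) permutes `ι → F ≃ F × (ι ∖ {i} → F)` as `m_u × id`, so its signature is `ϵ(m_u)^{q^{n−1}} · 1 = (u/𝔽_q)`
(`q` odd; Zolotarev's lemma `ϵ(m_u) = (u/𝔽_q)`). [cite: BrunyateClark2014, §1.1 Lemma 1.3 & §4.1 Thm. 4.1 (proof: "By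
Lemma 1.3, ϵ(D) = −1")] -/
theorem sign_eq_quadraticChar_det_diagonal_update (hF : ringChar F ≠ 2) (i : ι) {u : F} (hu : u ≠ 0)
    (σ : Perm (ι → F)) (hσ : ∀ v, σ v = diagonal (Function.update 1 i u) *ᵥ v) :
    ((Perm.sign σ : ℤˣ) : ℤ) = quadraticChar F (diagonal (Function.update (1 : ι → F) i u)).det := by
  -- `det diag(1, …, u, …, 1) = u`
  have hdet : (diagonal (Function.update (1 : ι → F) i u)).det = u := by
    rw [det_diagonal, Finset.prod_update_of_mem (Finset.mem_univ i)]
    simp only [Pi.one_apply, Finset.prod_const_one, mul_one]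
  -- along `ι → F ≃ F × ({j ≠ i} → F)` the permutation is `m_u × id`
  have hcomm : ∀ v : ι → F, Equiv.funSplitAt i F (σ v) =
      (Equiv.prodCongr (MulAction.toPerm (Units.mk0 u hu) : Perm F) (Equiv.refl ({j // j ≠ i} → F)))
        (Equiv.funSplitAt i F v) := by
    intro v
    refine Prod.ext ?_ (funext fun j => ?_)
    · simp only [Equiv.funSplitAt_apply, Equiv.prodCongr_apply, Prod.map_fst, hσ, mulVec_diagonal,
        Function.update_self, MulAction.toPerm_apply, Units.smul_def, Units.val_mk0, smul_eq_mul]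
    · simp only [Equiv.funSplitAt_apply, Equiv.prodCongr_apply, Prod.map_snd, hσ, mulVec_diagonal,
        Function.update_of_ne j.2, Pi.one_apply, one_mul, Equiv.refl_apply]
  have hq : Odd (Fintype.card F) := Nat.odd_iff.mpr (FiniteField.odd_card_of_char_ne_two hF)
  have hodd : Odd (Fintype.card ({j // j ≠ i} → F)) := by
    rw [Fintype.card_fun]
    exact hq.pow
  rw [sign_eq_sign_of_equiv σ _ (Equiv.funSplitAt i F) hcomm, sign_prodCongr, Perm.sign_refl, Units.val_one, one_pow,
    mul_one, units_int_pow_of_odd _ hodd, sign_toPerm_eq_quadraticChar hF (Units.mk0 u hu), Units.val_mk0, hdet]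

/-- **Lemma 1.3 iterated: invertible diagonal matrices.** `sign(v ↦ D v) = ∏ᵢ (dᵢ/𝔽_q) = (det D / 𝔽_q)`, peeling off
one diagonal entry at a time (`diag(d) = diag(1, …, dᵢ, …, 1) · diag(d with dᵢ ↦ 1)`).
[cite: BrunyateClark2014, §1.1 Lemma 1.3 & §4.1 Thm. 4.1 (proof)] -/
theorem sign_eq_quadraticChar_det_diagonal (hF : ringChar F ≠ 2) {D : ι → F} (hD : (diagonal D).det ≠ 0)
    (σ : Perm (ι → F)) (hσ : ∀ v, σ v = diagonal D *ᵥ v) :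
    ((Perm.sign σ : ℤˣ) : ℤ) = quadraticChar F (diagonal D).det := by
  have hD' : ∀ i, D i ≠ 0 := fun i => by
    rw [det_diagonal] at hD
    exact Finset.prod_ne_zero_iff.mp hD i (Finset.mem_univ i)
  -- induction over the finite set `s` of places where the entry `D i` (rather than `1`) is used
  suffices h : ∀ (s : Finset ι) (σ : Perm (ι → F)), (∀ v, σ v = diagonal (fun i => if i ∈ s then D i else 1) *ᵥ v) →
      ((Perm.sign σ : ℤˣ) : ℤ) = quadraticChar F (diagonal fun i => if i ∈ s then D i else 1).det by
    have hu : (fun i => if i ∈ (Finset.univ : Finset ι) then D i else 1) = D :=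
      funext fun i => if_pos (Finset.mem_univ i)
    have h' := h Finset.univ σ
    rw [hu] at h'
    exact h' hσ
  intro s
  induction s using Finset.induction_on with
  | empty =>
    intro σ hσ
    have h1 : (diagonal fun i : ι => if i ∈ (∅ : Finset ι) then D i else (1 : F)) = 1 := by
      rw [← diagonal_one]
      congr 1
    rw [h1] at hσ ⊢
    have hσ1 : σ = 1 := Equiv.ext fun v => by rw [hσ, one_mulVec, Perm.coe_one, id]
    rw [hσ1, Perm.sign_one, Units.val_one, det_one, map_one]
  | insert i s hi ih =>
    intro σ hσ
    have hsplit : (diagonal fun j : ι => if j ∈ insert i s then D j else (1 : F)) =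
        diagonal (Function.update (1 : ι → F) i (D i)) * diagonal (fun j => if j ∈ s then D j else 1) := by
      rw [diagonal_mul_diagonal]
      congr 1
      funext j
      by_cases hj : j = i
      · subst hj
        rw [Function.update_self, if_pos (Finset.mem_insert_self _ _), if_neg hi, mul_one]
      · rw [Function.update_of_ne hj, Pi.one_apply, one_mul]
        simp only [Finset.mem_insert, hj, false_or]
    have hdet1 : (diagonal (Function.update (1 : ι → F) i (D i))).det ≠ 0 := by
      rw [det_diagonal, Finset.prod_update_of_mem (Finset.mem_univ i)]
      simp only [Pi.one_apply, Finset.prod_const_one, mul_one]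
      exact hD' i
    have hdet2 : (diagonal fun j : ι => if j ∈ s then D j else (1 : F)).det ≠ 0 := by
      rw [det_diagonal]
      exact Finset.prod_ne_zero_iff.mpr fun j _ => by
        split_ifs
        · exact hD' j
        · exact one_ne_zero
    rw [hsplit] at hσ ⊢
    exact sign_eq_quadraticChar_det_mul hdet1 hdet2 (sign_eq_quadraticChar_det_diagonal_update hF i (hD' i)) ih σ hσ

/-! ### Theorem 4.1 -/

/-- **Theorem 4.1 (b) in coordinates**: for an invertible matrix `A` over a finite field `F` of odd characteristic, the
permutation `σ : v ↦ A v` of `ι → F` has signature `(det A / F)` = `quadraticChar F (det A)` (read in `ℤ`).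
[cite: BrunyateClark2014, §4.1 Thm. 4.1 (b)] -/
theorem sign_eq_quadraticChar_det (hF : ringChar F ≠ 2) {A : Matrix ι ι F} (hA : A.det ≠ 0) (σ : Perm (ι → F))
    (hσ : ∀ v, σ v = A *ᵥ v) : ((Perm.sign σ : ℤˣ) : ℤ) = quadraticChar F A.det := by
  refine diagonal_transvection_induction_of_det_ne_zero
    (fun M : Matrix ι ι F => ∀ σ : Perm (ι → F), (∀ v, σ v = M *ᵥ v) → ((Perm.sign σ : ℤˣ) : ℤ) = quadraticChar F M.det)
    A hA (fun D hD σ hσ => sign_eq_quadraticChar_det_diagonal hF hD σ hσ) (fun t σ hσ => ?_)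
    (fun A B hA hB PA PB σ hσ => sign_eq_quadraticChar_det_mul hA hB PA PB σ hσ) σ hσ
  rw [sign_eq_one_of_transvection hF t.hij t.c σ hσ, Units.val_one, t.det, map_one]

/-- **Theorem 4.1 (b)** (Frobenius): for a finite field `F` of odd characteristic and an `F`-linear automorphism `m` of a
finite `F`-vector space `V`, the signature of `m` as a permutation of `V` is `ϵ(m) = det(m) (mod F^{×2})`, i.e.
`sign m = quadraticChar F (det m)` (read in `ℤ`). [cite: BrunyateClark2014, §4.1 Thm. 4.1 (b)] -/
theorem sign_toEquiv_eq_quadraticChar_det (hF : ringChar F ≠ 2) {V : Type*} [AddCommGroup V] [Module F V] [Fintype V]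
    [DecidableEq V] (f : V ≃ₗ[F] V) :
    ((Perm.sign (f.toEquiv : Perm V) : ℤˣ) : ℤ) = quadraticChar F (LinearMap.det (f : V →ₗ[F] V)) := by
  classical
  let b := Module.Free.chooseBasis F V
  have hAdet : (LinearMap.toMatrix b b (f : V →ₗ[F] V)).det ≠ 0 := by
    rw [LinearMap.det_toMatrix]
    exact f.isUnit_det'.ne_zero
  -- in coordinates `b.equivFun : V ≃ (ι → F)`, `f` is `v ↦ A v` with `A` the matrix of `f`
  obtain ⟨σ, hσ⟩ : ∃ σ : Perm (Module.Free.ChooseBasisIndex F V → F),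
      ∀ v, σ v = LinearMap.toMatrix b b (f : V →ₗ[F] V) *ᵥ v :=
    ⟨(b.equivFun.symm.trans ((f.trans b.equivFun))).toEquiv, fun v => by
      have hv : (b.repr (b.equivFun.symm v) : Module.Free.ChooseBasisIndex F V → F) = v := by
        rw [← Module.Basis.equivFun_apply, LinearEquiv.apply_symm_apply]
      have key := LinearMap.toMatrix_mulVec_repr b b (f : V →ₗ[F] V) (b.equivFun.symm v)
      rw [hv] at key
      rw [LinearEquiv.coe_toEquiv, LinearEquiv.trans_apply, LinearEquiv.trans_apply, Module.Basis.equivFun_apply]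
      exact key.symm⟩
  have hcomm : ∀ x : V, b.equivFun.toEquiv (f.toEquiv x) = σ (b.equivFun.toEquiv x) := fun x => by
    rw [LinearEquiv.coe_toEquiv, LinearEquiv.coe_toEquiv, hσ, Module.Basis.equivFun_apply, Module.Basis.equivFun_apply,
      LinearMap.toMatrix_mulVec_repr]
    rfl
  rw [sign_eq_sign_of_equiv _ σ b.equivFun.toEquiv hcomm, sign_eq_quadraticChar_det hF hAdet σ hσ, LinearMap.det_toMatrix]

end Literature.LinearAlgebra
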